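import Summits.ResolutionOfSingularities.ResolutionOfSingularities.Theorems.PurelyInseparableDim4Target
import Literature.AlgebraicGeometry.Resolution.CentreBlowupMohStability
import Literature.AlgebraicGeometry.Resolution.CentreBlowupOrdAlongBasics
import Literature.AlgebraicGeometry.Resolution.WeightedBlowupNoIncrease
import HarnessLib

/-!
# Purely inseparable hypersurfaces: the LUCAS-CARRIED CEILING of the residual order after a
# coordinate-centre step (census card I-9-1, Theorem A / Corollary B of idea-9's PROOF-A) — kernel form

[OURS · counted 0] (cell `res-dim4-pi`, D-0157 DOOR 2; desk row of record I-9-1, idea card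
`HOME/cards/idea-9.md`, written proof `HOME/res-dim4-idea-9/PROOF-A.md` 649a9ba4c9580c23 by res-dim4-idea-9;
typed and proved here by res-dim4-typ-2 over the TREE's coordinate-centre step `CentreBlowup.step`
(`PointBlowupShadeCentres.lean`). A statement about OUR model walk; nothing here proves resolution of
singularities in dimension ≥ 4 / characteristic `p`.)

Setting (tree semantics, any finite index type `σ`, any field `K` of characteristic `p`): a presented
state `s = (F, r, exc)` (`CentreBlowup.CState`), a centre `S`, chart `j`, translation vector `b` with
`b_j = 0` (translations off `S` allowed — «points along the centre»), exponent `q`. The uncleaned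
transform is `F⁺ = CentreBlowup.pointTransform q S j b s = translate b (chartTransform q S j F)`; the next
state is `step q S j b s = (deletePthPowers q F⁺, newMult, newExc)`, with shade
`d′ = ord₀ (deletePthPowers q F⁺) − |newMult|`.

* `coeff_pointTransform` — **expansion** (PROOF-A §2): `coef_α(F⁺) = Σ_{a ∈ supp F} c_a · ∏ᵢ C(e(a)ᵢ, αᵢ) · bᵢ^{e(a)ᵢ − αᵢ}`,
  `e(a) = chartExponent q S j a`;
* `term_eq_zero_of_not_isSource` — a summand vanishes unless `a` is a LUCAS-ADMISSIBLE SOURCE of `α`: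
  `αᵢ = e(a)ᵢ` at every untranslated `i` (`bᵢ = 0`) and `p ∤ C(aᵢ, αᵢ)` at every translated `i` (by
  Lucas' theorem this is PROOF-A's digitwise `αᵢ ≤_p aᵢ`; tree `DigitLemma.digitLE_iff_not_dvd_choose`);
* **`coeff_pointTransform_of_unique_source`, `coeff_pointTransform_ne_zero_of_unique_source`** — if `α`
  has EXACTLY ONE admissible source `a₀` then `coef_α(F⁺) = c_{a₀} · ∏_{bᵢ ≠ 0} C(a₀ᵢ, αᵢ) bᵢ^{a₀ᵢ − αᵢ} ≠ 0`
  (PROOF-A §3, first half);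
* **`mem_support_step_of_unique_source`** — if moreover `α ≢ 0 mod q` (`¬ IsPthPowerExponent q α`) then
  `y^α` survives cleaning: `α ∈ supp (step q S j b s).F`;
* **`shade_step_le_of_unique_source`** — THEOREM A: `d′ ≤ |α| − |r′|` for every such `α`, where
  `r′ = (step q S j b s).r` is the tree's bookkept new multiplicity vector
  (`newMult`: `r′_j = ord_{(x_S)} F − q`, `r′ᵢ = rᵢ` at kept untranslated components, translated
  components dropped) — so PROOF-A's `L♯ = min_α |α| − (ord_Γ F − q) − Σ rᵢ` bounds `d′` α by α, with
  the `r′`-part EXACT in the tree's semantics;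
* **`shade_step_lt_of_unique_source`** — COROLLARY B: an `α` with `|α| − |r′| < d` certifies a DROP.

Differences from PROOF-A §0, flagged: (i) translations `bᵢ ≠ 0` are allowed at any `i ≠ j` (PROOF-A: only
`i ∈ Γ ∖ j`; same proof); (ii) `r′` is the tree's bookkept vector, not «recomputed on the cleaned child».
What is NOT here: PROOF-A's (C), (D), (F′) (census bets); the `Finset`-valued letter `L♯` itself (the
bound is stated per witness `α`, which is what a census certificate exhibits).
bears_on: LADDER-RESOLUTION:D157-DOOR2 (res-dim4-pi · I-9-1 (A)). Supports
stmt-ResolutionOfSingularities-16155 (helper).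
-/

-- every declaration of this summit lives under `Summit.ResolutionOfSingularities.ResolutionOfSingularities`
-- (summit = problem), which the duplicate-namespace linter flags; house convention (cf. the Target file).
set_option linter.dupNamespace false

noncomputable section

open MvPolynomial Finset

open scoped BigOperators

namespace Summit.ResolutionOfSingularities.ResolutionOfSingularities.Theorems.PIDim4

open Literature.AlgebraicGeometry.Resolution
open Literature.AlgebraicGeometry.Resolution.Hauser2010
open Literature.Barriers.ResolutionOfSingularities

namespace LucasCeiling

variable {σ : Type*} [Fintype σ] [DecidableEq σ] {K : Type*} [Field K] [DecidableEq K]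

/-! ## §1 Expansion of the uncleaned transform -/

omit [DecidableEq K] in
/-- **Expansion (PROOF-A §2).** The coefficient of `y^α` in the uncleaned transform
`F⁺ = translate b (chartTransform q S j F)` is
`Σ_{a ∈ supp F} c_a · ∏ᵢ C(e(a)ᵢ, αᵢ) · bᵢ^{e(a)ᵢ − αᵢ}`, `e(a) = chartExponent q S j a`. -/
theorem coeff_pointTransform (q : ℕ) (S : Finset σ) (j : σ) (b : σ → K) (s : CentreBlowup.CState σ K)
    (α : σ →₀ ℕ) :
    coeff α (CentreBlowup.pointTransform q S j b s) =
      ∑ a ∈ s.F.support, coeff a s.F *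
        ∏ i, (((CentreBlowup.chartExponent q S j a i).choose (α i) : K) *
          b i ^ (CentreBlowup.chartExponent q S j a i - α i)) := by
  rw [CentreBlowup.pointTransform_eq_sum, coeff_sum]
  exact Finset.sum_congr rfl fun a _ => WeightedBlowup.coeff_translate_monomial b _ α _

omit [Fintype σ] [DecidableEq σ] [DecidableEq K] in
/-- At an untranslated variable (`bᵢ = 0`) the `i`-th factor of the summand of `a` is `1` if
`αᵢ = e(a)ᵢ` and `0` otherwise. -/
theorem factor_of_apply_eq_zero {b : σ → K} {i : σ} (hbi : b i = 0) (e α : ℕ) :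
    ((e.choose α : K) * b i ^ (e - α)) = if α = e then 1 else 0 := by
  rw [hbi]
  by_cases h : α = e
  · rw [if_pos h, h, Nat.choose_self, Nat.cast_one, Nat.sub_self, pow_zero, mul_one]
  · rw [if_neg h]
    rcases Nat.lt_or_gt_of_ne h with hlt | hgt
    · rw [zero_pow (Nat.sub_ne_zero_of_lt hlt), mul_zero]
    · rw [Nat.choose_eq_zero_of_lt hgt, Nat.cast_zero, zero_mul]

omit [DecidableEq K] in
/-- **Only Lucas-admissible sources contribute.** For `b_j = 0` and `p = char K`: the summand of
`a ∈ supp F` in `coef_α(F⁺)` vanishes unless `αᵢ = e(a)ᵢ` at every untranslated `i` and `p ∤ C(aᵢ, αᵢ)`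
at every translated `i` (there `e(a)ᵢ = aᵢ`). -/
theorem term_eq_zero_of_not_isSource (p : ℕ) [Fact p.Prime] [CharP K p] (q : ℕ) (S : Finset σ)
    {j : σ} {b : σ → K} (hbj : b j = 0) (s : CentreBlowup.CState σ K) (α a : σ →₀ ℕ)
    (h : ¬ ((∀ i, b i = 0 → α i = CentreBlowup.chartExponent q S j a i) ∧
      (∀ i, b i ≠ 0 → ¬ p ∣ (a i).choose (α i)))) :
    coeff a s.F * ∏ i, (((CentreBlowup.chartExponent q S j a i).choose (α i) : K) *
      b i ^ (CentreBlowup.chartExponent q S j a i - α i)) = 0 := by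
  rw [not_and_or, not_forall, not_forall] at h
  rcases h with ⟨i, hi⟩ | ⟨i, hi⟩
  · rw [Classical.not_imp] at hi
    apply mul_eq_zero_of_right
    apply Finset.prod_eq_zero (Finset.mem_univ i)
    rw [factor_of_apply_eq_zero hi.1, if_neg hi.2]
  · rw [Classical.not_imp, not_not] at hi
    have hij : i ≠ j := fun h => hi.1 (h ▸ hbj)
    apply mul_eq_zero_of_right
    apply Finset.prod_eq_zero (Finset.mem_univ i)
    rw [CentreBlowup.chartExponent_apply_of_ne q S hij, (CharP.cast_eq_zero_iff K p _).mpr hi.2, zero_mul]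

/-! ## §2 Unique-source images have non-zero coefficient (Lucas) -/

section UniqueSource

variable (p : ℕ) [Fact p.Prime] [CharP K p] (q : ℕ) (S : Finset σ) {j : σ} {b : σ → K}
  (hbj : b j = 0) (s : CentreBlowup.CState σ K) {α a₀ : σ →₀ ℕ} (ha₀ : a₀ ∈ s.F.support)
  (hsrc : (∀ i, b i = 0 → α i = CentreBlowup.chartExponent q S j a₀ i) ∧
    (∀ i, b i ≠ 0 → ¬ p ∣ (a₀ i).choose (α i)))
  (huniq : ∀ a ∈ s.F.support, (∀ i, b i = 0 → α i = CentreBlowup.chartExponent q S j a i) →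
    (∀ i, b i ≠ 0 → ¬ p ∣ (a i).choose (α i)) → a = a₀)

include hbj hsrc huniq ha₀

omit [DecidableEq K] hsrc in
/-- **Unique source ⇒ exact coefficient (PROOF-A §3).** If `α` has exactly one Lucas-admissible source
`a₀ ∈ supp F`, then `coef_α(F⁺)` is the single summand of `a₀`. -/
theorem coeff_pointTransform_of_unique_source :
    coeff α (CentreBlowup.pointTransform q S j b s) =
      coeff a₀ s.F * ∏ i, (((CentreBlowup.chartExponent q S j a₀ i).choose (α i) : K) *
        b i ^ (CentreBlowup.chartExponent q S j a₀ i - α i)) := by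
  rw [coeff_pointTransform]
  refine Finset.sum_eq_single a₀ (fun a ha hne => ?_) (fun h => absurd ha₀ h)
  exact term_eq_zero_of_not_isSource p q S hbj s α a fun hs => hne (huniq a ha hs.1 hs.2)

omit [DecidableEq K] in
/-- **… and it is non-zero**: `c_{a₀} ≠ 0`, each `C(a₀ᵢ, αᵢ) ≢ 0 (mod p)` (Lucas-admissibility), each
translated `bᵢ ≠ 0`, and the untranslated factors are `1`. -/
theorem coeff_pointTransform_ne_zero_of_unique_source :
    coeff α (CentreBlowup.pointTransform q S j b s) ≠ 0 := by
  rw [coeff_pointTransform_of_unique_source p q S hbj s ha₀ huniq]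
  refine mul_ne_zero (MvPolynomial.mem_support_iff.mp ha₀) (Finset.prod_ne_zero_iff.mpr fun i _ => ?_)
  by_cases hbi : b i = 0
  · rw [factor_of_apply_eq_zero hbi, if_pos (hsrc.1 i hbi)]
    exact one_ne_zero
  · have hij : i ≠ j := fun h => hbi (h ▸ hbj)
    rw [CentreBlowup.chartExponent_apply_of_ne q S hij]
    exact mul_ne_zero (fun h => hsrc.2 i hbi ((CharP.cast_eq_zero_iff K p _).mp h))
      (pow_ne_zero _ hbi)

/-- **Unique-source images that are not `q`-th powers survive the cleaning**: `α ∈ supp (step q S j b s).F`. -/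
theorem mem_support_step_of_unique_source (hα : ¬ IsPthPowerExponent q α) :
    α ∈ (CentreBlowup.step q S j b s).F.support := by
  rw [MvPolynomial.mem_support_iff]
  change coeff α (deletePthPowers q (CentreBlowup.pointTransform q S j b s)) ≠ 0
  rw [coeff_deletePthPowers, if_neg hα]
  exact coeff_pointTransform_ne_zero_of_unique_source p q S hbj s ha₀ hsrc huniq

/-- **THEOREM A (Lucas-carried ceiling, PROOF-A §3), tree semantics.** For every image `α` with exactly
one Lucas-admissible source and `α ≢ 0 (mod q)`: the shade of the next state satisfies
`d′ ≤ |α| − |r′|`, `r′ = (step q S j b s).r` the bookkept new multiplicities — i.e. `d′ ≤ L♯` for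
PROOF-A's letter `L♯ = min_α (|α| − |r′|)`. -/
theorem shade_step_le_of_unique_source (hα : ¬ IsPthPowerExponent q α) :
    (CentreBlowup.step q S j b s).shade ≤
      (α.degree : ℕ∞) - ((CentreBlowup.step q S j b s).r.degree : ℕ∞) := by
  unfold CentreBlowup.CState.shade
  exact tsub_le_tsub_right (ordZero_le_of_coeff_ne_zero _ α
    (MvPolynomial.mem_support_iff.mp (mem_support_step_of_unique_source p q S hbj s ha₀ hsrc huniq hα))) _

/-- **COROLLARY B (certified DROP).** If some such `α` has `|α| − |r′| < d` (the shade of `s`), then the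
step DROPS the shade: `d′ < d`. -/
theorem shade_step_lt_of_unique_source (hα : ¬ IsPthPowerExponent q α)
    (hlt : (α.degree : ℕ∞) - ((CentreBlowup.step q S j b s).r.degree : ℕ∞) < s.shade) :
    (CentreBlowup.step q S j b s).shade < s.shade :=
  (shade_step_le_of_unique_source p q S hbj s ha₀ hsrc huniq hα).trans_lt hlt

end UniqueSource

/-! ## §3 The bookkept multiplicities `r′` -/

omit [Fintype σ] in
/-- The new multiplicity vector of the tree's step: `r′ = (r|_{bᵢ = 0}).update j (ord_{(x_S)} F − q)`. -/
theorem step_r (q : ℕ) (S : Finset σ) (j : σ) (b : σ → K) (s : CentreBlowup.CState σ K) :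
    (CentreBlowup.step q S j b s).r =
      (s.r.filter fun i => b i = 0).update j ((CentreBlowup.ordAlong S s.F).toNat - q) := rfl

/-- **`|r′| = (ord_{(x_S)} F − q) + Σ_{i ≠ j, bᵢ = 0} rᵢ`** (`b_j = 0`): the `r′`-part of PROOF-A's `L♯`,
exact in the tree's bookkeeping. -/
theorem degree_step_r (q : ℕ) (S : Finset σ) {j : σ} {b : σ → K} (hbj : b j = 0)
    (s : CentreBlowup.CState σ K) :
    (CentreBlowup.step q S j b s).r.degree + s.r j =
      (s.r.filter fun i => b i = 0).degree + ((CentreBlowup.ordAlong S s.F).toNat - q) := by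
  have h := PointBlowup.degree_update_add (s.r.filter fun i => b i = 0) j
    ((CentreBlowup.ordAlong S s.F).toNat - q)
  rw [Finsupp.filter_apply, if_pos hbj] at h
  rw [step_r]
  exact h

end LucasCeiling

end Summit.ResolutionOfSingularities.ResolutionOfSingularities.Theorems.PIDim4

end
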